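import Summits.CriticalPhenomena.PercolationContinuityZ3.Theorems.PercNearOneGluingNoHeavyLowerTailThreePointHubEvents
import Summits.CriticalPhenomena.PercolationContinuityZ3.Theorems.PercNearOneGluingNoHeavyLowerTailThreePointVarianceCutVertex
import HarnessLib

/-!
# The three-point variance row `(3PT)` for parallel compositions of `(K)`-pieces glued at the three terminals

Support file for crux `stmt-CriticalPhenomena-4575` (`NoHeavyLowerTail`), seat `prim-l12-p1` gen 20 (`--supports stmt-CriticalPhenomena-4575`).
Memo `run/shared/lean/prim/prim-l12/FROM-prim-l12-p1-g20-*.md`; it generalises gen 19's Theorem H (`…ThreePointHubGraphs`, hub graphs).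

Bond percolation `μ = prodBernoulli w` on a finite vertex type `V`, pairwise distinct terminals `a b c`.  A PIECE STRUCTURE is a
labelling `part : V → ι` of the vertices by a finite index type; piece `i` is the set of NON-terminal vertices with label `i`, and the
weight function is a PARALLEL COMPOSITION of the pieces (glued at `a, b, c`) when every pair of non-terminals with different labels
has weight `0`.  The pairs of piece `i` (`piecePairs`) are the pairs with one end in piece `i` and the other in piece `i` or a terminal;
these pair sets are pairwise disjoint and disjoint from the three terminal pairs.  For a piece `i` and a terminal `x` the cylinder event
`isoPiece i x y z` says "no open path from `x` to `y` or to `z` using pairs of piece `i` only"; it is determined by `piecePairs i`.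

* `isoP_iff` [this work]: off the null event `badP` (some cross-piece pair open), `x` is isolated from `y, z` iff its two terminal pairs
  are closed and `isoPiece i x y z` holds for every piece `i` (closure of `{x} ∪ {v : x reaches v inside v's piece}` under open adjacency).
* `real_isoP`, `real_sepP` [this work]: hence `Q = P(sep)`, `A = P(c isolated)`, `B = P(b isolated)`, `C = P(a isolated)` are the terminal
  factors times the PRODUCTS over the pieces of the piece quantities `Qᵢ, Aᵢ, Bᵢ, Cᵢ` (independence over disjoint pair sets).
* (next file `…ThreePointPiecesParallel.lean`, `threePointVariance_of_pieces`) if every piece satisfies the isolation criterion `(K)`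
  `Qᵢ³ ≤ Aᵢ²BᵢCᵢ, Qᵢ³ ≤ AᵢBᵢ²Cᵢ, Qᵢ³ ≤ AᵢBᵢCᵢ²` (gen 19, `ThreePointIsoProduct`), then
  `(3PT)  P(a↔b)·P(a↮b) ≤ P(a↔b, a↮c) + P(a↔c, a↮b) + P(b↔c, a↮b)`
  — because `(K)` is product-closed (`isoK_prod`), holds for the terminal triangle (`tri_isoK`) and implies `2Q − A ≤ (B+C−Q)²`
  (`threePoint_of_isoK`).  Pieces known to satisfy `(K)`: single hubs (Theorem H), and — next file — every piece in which one terminal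
  separates the other two; `(K)` fails for some two-hub pieces by `6·10⁻⁵` (memo gen 19 §7), so the hypothesis is per piece, not universal.
-/

namespace Summit.CriticalPhenomena.PercolationContinuityZ3.Theorems.ThreePointPieces

open MeasureTheory Set
open Literature.Probability.Percolation Literature.Probability.LatticeModels
open Summit.CriticalPhenomena.PercolationContinuityZ3.Theorems.ThreePointHubEvents (tClosed determinedBy_of_iff
  determinedBy_tClosed real_tClosed real_tClosed_inter)

variable {V : Type*} [Fintype V] [DecidableEq V] {ι : Type*} [Fintype ι] [DecidableEq ι]

/-! ## Pieces, their pairs, their events -/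

/-- The three terminals as a finset. [this work] -/
def terms (a b c : V) : Finset V := {a, b, c}

omit [Fintype V] in
/-- Membership in `terms`. [this work] -/
@[simp] theorem mem_terms {a b c v : V} : v ∈ terms a b c ↔ v = a ∨ v = b ∨ v = c := by
  simp [terms]

/-- Piece `i`: the non-terminal vertices labelled `i`. [this work] -/
def piece (a b c : V) (part : V → ι) (i : ι) : Finset V := Finset.univ.filter fun v => v ∉ terms a b c ∧ part v = i

omit [Fintype ι] in
/-- Membership in `piece`. [this work] -/
@[simp] theorem mem_piece {a b c : V} {part : V → ι} {i : ι} {v : V} :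
    v ∈ piece a b c part i ↔ v ∉ terms a b c ∧ part v = i := by
  simp [piece]

/-- The pairs of piece `i`: one end in piece `i`, the other in piece `i` or a terminal. [this work] -/
def piecePairs (a b c : V) (part : V → ι) (i : ι) : Finset (Sym2 V) :=
  ((piece a b c part i ×ˢ (piece a b c part i ∪ {a, b, c})).filter fun uv => uv.1 ≠ uv.2).image fun uv => s(uv.1, uv.2)

omit [Fintype ι] in
/-- Membership in `piecePairs`. [this work] -/
theorem mem_piecePairs {a b c : V} {part : V → ι} {i : ι} {e : Sym2 V} :
    e ∈ piecePairs a b c part i ↔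
      ∃ u v, (u ∉ terms a b c ∧ part u = i) ∧ ((v ∉ terms a b c ∧ part v = i) ∨ v ∈ terms a b c) ∧ u ≠ v ∧ e = s(u, v) := by
  simp only [piecePairs, Finset.mem_image, Finset.mem_filter, Finset.mem_product, mem_piece, Finset.mem_union,
    Prod.exists]
  constructor
  · rintro ⟨u, v, ⟨⟨hu, hv⟩, huv⟩, rfl⟩; exact ⟨u, v, hu, hv, huv, rfl⟩
  · rintro ⟨u, v, hu, hv, huv, rfl⟩; exact ⟨u, v, ⟨⟨hu, hv⟩, huv⟩, rfl⟩

omit [Fintype ι] in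
/-- A pair `s(u,v)` with `u` in piece `i` and `v` in piece `i` or a terminal, `u ≠ v`, is a pair of piece `i`. [this work] -/
theorem mk_mem_piecePairs {a b c : V} {part : V → ι} {i : ι} {u v : V} (hu : u ∉ terms a b c) (hui : part u = i)
    (hv : (v ∉ terms a b c ∧ part v = i) ∨ v ∈ terms a b c) (huv : u ≠ v) : s(u, v) ∈ piecePairs a b c part i :=
  mem_piecePairs.2 ⟨u, v, ⟨hu, hui⟩, hv, huv, rfl⟩

/-- The pair sets of distinct pieces are disjoint. [this work] -/
theorem pairwiseDisjoint_piecePairs (a b c : V) (part : V → ι) :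
    (↑(Finset.univ : Finset ι) : Set ι).PairwiseDisjoint fun i => piecePairs a b c part i := by
  intro i _ j _ hij
  simp only [Function.onFun, Finset.disjoint_left]
  intro e hei hej
  obtain ⟨u, v, ⟨hu, hui⟩, hv, -, rfl⟩ := mem_piecePairs.1 hei
  obtain ⟨u', v', ⟨hu', hu'j⟩, hv', -, he⟩ := mem_piecePairs.1 hej
  rcases Sym2.eq_iff.1 he with ⟨rfl, rfl⟩ | ⟨rfl, rfl⟩
  · exact hij (hui.symm.trans hu'j)
  · rcases hv' with ⟨-, h⟩ | h
    · exact hij (hui.symm.trans h)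
    · exact hu h

omit [Fintype ι] in
/-- A terminal pair is not a pair of any piece. [this work] -/
theorem termPair_not_mem_piecePairs {a b c : V} {part : V → ι} {i : ι} {p q : V} (hp : p ∈ terms a b c) (hq : q ∈ terms a b c) :
    s(p, q) ∉ piecePairs a b c part i := by
  intro h
  obtain ⟨u, v, ⟨hu, -⟩, -, -, he⟩ := mem_piecePairs.1 h
  rcases Sym2.eq_iff.1 he with ⟨rfl, -⟩ | ⟨-, rfl⟩
  · exact hu hp
  · exact hu hq

/-- "`x` reaches `y` using pairs of `F` only". [this work] -/
def pieceConn (F : Finset (Sym2 V)) (x y : V) : Set (BondConfig V) := {ω | (openGraph (ω ∩ ↑F)).Reachable x y}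

/-- The piece isolation event of `x` (from `y` and `z`) on the pair set `F`. [this work] -/
def isoPiece (F : Finset (Sym2 V)) (x y z : V) : Set (BondConfig V) := (pieceConn F x y)ᶜ ∩ (pieceConn F x z)ᶜ

/-- The cylinder form of "`x` is isolated from `y` and `z`" for a piece structure. [this work] -/
def isoP (a b c : V) (part : V → ι) (x y z : V) : Set (BondConfig V) :=
  tClosed x y z ∩ ⋂ i ∈ (Finset.univ : Finset ι), isoPiece (piecePairs a b c part i) x y z

/-- The null event: some pair of non-terminals in different pieces is open. [this work] -/
def badP (a b c : V) (part : V → ι) : Set (BondConfig V) :=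
  {ω | ∃ u v, u ∉ terms a b c ∧ v ∉ terms a b c ∧ part u ≠ part v ∧ s(u, v) ∈ ω}

omit [Fintype V] [DecidableEq V] in
/-- `pieceConn F x y` is determined by `F`. [this work] -/
theorem determinedBy_pieceConn (F : Finset (Sym2 V)) (x y : V) : DeterminedBy (pieceConn F x y) (↑F : Set (Sym2 V)) := by
  rw [determinedBy_iff]
  intro ω ω' h
  simp only [pieceConn, mem_setOf_eq, h]

omit [Fintype V] [DecidableEq V] in
/-- `isoPiece F x y z` is determined by `F`. [this work] -/
theorem determinedBy_isoPiece (F : Finset (Sym2 V)) (x y z : V) : DeterminedBy (isoPiece F x y z) (↑F : Set (Sym2 V)) :=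
  (OneLayerTwoFinger.determinedBy_compl (determinedBy_pieceConn F x y)).inter
    (OneLayerTwoFinger.determinedBy_compl (determinedBy_pieceConn F x z))

/-! ## The closure argument: `isoP` is isolation, off the null event -/

section walks
variable {a b c : V} {part : V → ι} {x y z : V} {ω : BondConfig V}

/-- The vertices reachable from an isolated `x`: `x` itself and the non-terminals reached from `x` inside their own piece. [this work] -/
def reachP (a b c : V) (part : V → ι) (x : V) (ω : BondConfig V) : Set V :=
  {v | v = x ∨ (v ∉ terms a b c ∧ ω ∈ pieceConn (piecePairs a b c part (part v)) x v)}

omit [Fintype V] [DecidableEq V] in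
/-- One open step inside a piece extends piece-reachability. [this work] -/
theorem pieceConn_step {F : Finset (Sym2 V)} {u v : V} (hu : ω ∈ pieceConn F x u) (he : s(u, v) ∈ ω) (hF : s(u, v) ∈ F)
    (huv : u ≠ v) : ω ∈ pieceConn F x v := by
  refine SimpleGraph.Reachable.trans hu (SimpleGraph.Adj.reachable ?_)
  rw [openGraph_adj]
  exact ⟨⟨he, Finset.mem_coe.2 hF⟩, huv⟩

/-- `reachP` is closed under open adjacency (on `isoP`, off the null event), when `x, y, z` are the three terminals. [this work] -/
theorem reachP_closed (hT : ∀ v, v ∈ terms a b c → v = x ∨ v = y ∨ v = z) (hx : x ∈ terms a b c)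
    (hω : ω ∈ isoP a b c part x y z) (hN : ω ∉ badP a b c part) {u v : V} (huv : (openGraph ω).Adj u v)
    (hu : u ∈ reachP a b c part x ω) : v ∈ reachP a b c part x ω := by
  rw [openGraph_adj] at huv
  obtain ⟨he, hne⟩ := huv
  obtain ⟨hTC, hI⟩ := hω
  simp only [mem_iInter, Finset.mem_univ, true_implies] at hI
  by_cases hvT : v ∈ terms a b c
  · -- `v` is a terminal: `v = x` is fine, `v = y` or `v = z` contradicts isolation
    rcases hT v hvT with rfl | rfl | rfl
    · exact Or.inl rfl
    · exfalso
      rcases hu with rfl | ⟨huT, hxu⟩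
      · exact hTC.1 he
      · exact (hI (part u)).1 (pieceConn_step hxu he (mk_mem_piecePairs huT rfl (Or.inr hvT) hne) hne)
    · exfalso
      rcases hu with rfl | ⟨huT, hxu⟩
      · exact hTC.2 he
      · exact (hI (part u)).2 (pieceConn_step hxu he (mk_mem_piecePairs huT rfl (Or.inr hvT) hne) hne)
  · -- `v` is a non-terminal
    refine Or.inr ⟨hvT, ?_⟩
    rcases hu with rfl | ⟨huT, hxu⟩
    · -- `u = x`: the pair `s(x,v)` belongs to `v`'s piece
      refine SimpleGraph.Adj.reachable ?_
      rw [openGraph_adj]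
      refine ⟨⟨he, Finset.mem_coe.2 ?_⟩, hne⟩
      rw [Sym2.eq_swap]
      exact mk_mem_piecePairs hvT rfl (Or.inr hx) (Ne.symm hne)
    · by_cases hp : part u = part v
      · rw [← hp]
        exact pieceConn_step hxu he (mk_mem_piecePairs huT rfl (Or.inl ⟨hvT, hp.symm⟩) hne) hne
      · exact (hN ⟨u, v, huT, hvT, hp, he⟩).elim

/-- Open walks from `reachP` stay in `reachP`. [this work] -/
theorem walkP_stays (hT : ∀ v, v ∈ terms a b c → v = x ∨ v = y ∨ v = z) (hx : x ∈ terms a b c)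
    (hω : ω ∈ isoP a b c part x y z) (hN : ω ∉ badP a b c part) :
    ∀ {u v : V} (_ : (openGraph ω).Walk u v), u ∈ reachP a b c part x ω → v ∈ reachP a b c part x ω := by
  intro u v p
  induction p with
  | nil => exact id
  | cons h _ ih => exact fun hu => ih (reachP_closed hT hx hω hN h hu)

/-- **`isoP x y z` is the isolation of `x` from `y` and `z`** (for `{x,y,z} = {a,b,c}` pairwise distinct, off the null event). [this work] -/
theorem isoP_iff (hT : ∀ v, v ∈ terms a b c → v = x ∨ v = y ∨ v = z) (hx : x ∈ terms a b c) (hy : y ∈ terms a b c)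
    (hz : z ∈ terms a b c) (hxy : x ≠ y) (hxz : x ≠ z) (hN : ω ∉ badP a b c part) :
    ω ∈ isoP a b c part x y z ↔ ¬ (openGraph ω).Reachable x y ∧ ¬ (openGraph ω).Reachable x z := by
  constructor
  · intro hω
    have hx0 : x ∈ reachP a b c part x ω := Or.inl rfl
    have hy0 : y ∉ reachP a b c part x ω := by
      rintro (h | ⟨h, -⟩)
      · exact hxy h.symm
      · exact h hy
    have hz0 : z ∉ reachP a b c part x ω := by
      rintro (h | ⟨h, -⟩)
      · exact hxz h.symm
      · exact h hz
    exact ⟨fun ⟨p⟩ => hy0 (walkP_stays hT hx hω hN p hx0), fun ⟨p⟩ => hz0 (walkP_stays hT hx hω hN p hx0)⟩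
  · rintro ⟨h1, h2⟩
    refine ⟨⟨fun h => h1 (SimpleGraph.Adj.reachable ((openGraph_adj _ _ _).2 ⟨h, hxy⟩)),
      fun h => h2 (SimpleGraph.Adj.reachable ((openGraph_adj _ _ _).2 ⟨h, hxz⟩))⟩, ?_⟩
    simp only [mem_iInter, Finset.mem_univ, true_implies]
    intro i
    have hsub : ω ∩ ↑(piecePairs a b c part i) ⊆ ω := inter_subset_left
    exact ⟨fun h => h1 (h.mono (openGraph_mono hsub)), fun h => h2 (h.mono (openGraph_mono hsub))⟩

end walks

/-! ## Probabilities: products over the pieces; the null event -/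

section prob
variable (w : Sym2 V → unitInterval) (a b c : V) (part : V → ι)

/-- `tClosed x y z` is determined by the complement of all piece pairs, when `x, y, z` are terminals. [this work] -/
theorem determinedBy_tClosed_complP {x y z : V} (hx : x ∈ terms a b c) (hy : y ∈ terms a b c) (hz : z ∈ terms a b c) :
    DeterminedBy (tClosed x y z) (⋃ i ∈ (Finset.univ : Finset ι), (↑(piecePairs a b c part i) : Set (Sym2 V)))ᶜ := by
  refine (determinedBy_tClosed (F := {s(x, y), s(x, z)}) (by simp) (by simp)).mono ?_
  intro e he hU
  simp only [Finset.coe_insert, Finset.coe_singleton, mem_insert_iff, mem_singleton_iff] at he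
  obtain ⟨i, -, hei⟩ := mem_iUnion₂.1 hU
  rcases he with rfl | rfl
  · exact termPair_not_mem_piecePairs hx hy (Finset.mem_coe.1 hei)
  · exact termPair_not_mem_piecePairs hx hz (Finset.mem_coe.1 hei)

/-- **`P(isoP x y z) = P(tClosed x y z) · ∏ᵢ P(isoPiece i x y z)`** (independence of the pieces' pair sets). [this work] -/
theorem real_isoP {x y z : V} (hx : x ∈ terms a b c) (hy : y ∈ terms a b c) (hz : z ∈ terms a b c) :
    (prodBernoulli w).real (isoP a b c part x y z) =
      (prodBernoulli w).real (tClosed x y z) *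
        ∏ i ∈ (Finset.univ : Finset ι), (prodBernoulli w).real (isoPiece (piecePairs a b c part i) x y z) := by
  unfold isoP
  exact prodBernoulli_real_inter_biInter_of_determinedBy w Finset.univ (fun i => piecePairs a b c part i)
    (pairwiseDisjoint_piecePairs a b c part) (fun i _ => determinedBy_isoPiece _ x y z) (fun _ _ => MeasurableSet.of_discrete)
    (determinedBy_tClosed_complP a b c part hx hy hz) MeasurableSet.of_discrete

/-- The cylinder form of `sep`. [this work] -/
theorem isoP_inter_isoP :
    isoP a b c part a b c ∩ isoP a b c part b a c =
      (tClosed a b c ∩ tClosed b a c) ∩ ⋂ i ∈ (Finset.univ : Finset ι),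
        (isoPiece (piecePairs a b c part i) a b c ∩ isoPiece (piecePairs a b c part i) b a c) := by
  ext ω
  simp only [isoP, mem_inter_iff, mem_iInter, Finset.mem_univ, true_implies]
  constructor
  · rintro ⟨⟨h1, h2⟩, h3, h4⟩; exact ⟨⟨h1, h3⟩, fun i => ⟨h2 i, h4 i⟩⟩
  · rintro ⟨⟨h1, h3⟩, h2⟩; exact ⟨⟨h1, fun i => (h2 i).1⟩, h3, fun i => (h2 i).2⟩

/-- **`P(isoP a b c ∩ isoP b a c) = P(all terminal pairs closed) · ∏ᵢ P(sep inside piece i)`.** [this work] -/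
theorem real_sepP :
    (prodBernoulli w).real (isoP a b c part a b c ∩ isoP a b c part b a c) =
      (prodBernoulli w).real (tClosed a b c ∩ tClosed b a c) *
        ∏ i ∈ (Finset.univ : Finset ι), (prodBernoulli w).real
          (isoPiece (piecePairs a b c part i) a b c ∩ isoPiece (piecePairs a b c part i) b a c) := by
  rw [isoP_inter_isoP]
  have ha : a ∈ terms a b c := mem_terms.2 (Or.inl rfl)
  have hb : b ∈ terms a b c := mem_terms.2 (Or.inr (Or.inl rfl))
  have hc : c ∈ terms a b c := mem_terms.2 (Or.inr (Or.inr rfl))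
  exact prodBernoulli_real_inter_biInter_of_determinedBy w Finset.univ (fun i => piecePairs a b c part i)
    (pairwiseDisjoint_piecePairs a b c part)
    (fun i _ => (determinedBy_isoPiece _ a b c).inter (determinedBy_isoPiece _ b a c)) (fun _ _ => MeasurableSet.of_discrete)
    ((determinedBy_tClosed_complP a b c part ha hb hc).inter (determinedBy_tClosed_complP a b c part hb ha hc))
    MeasurableSet.of_discrete

omit [Fintype ι] in
/-- The null event has probability `0` for a parallel composition. [this work] -/
theorem real_badP (hw : ∀ u v : V, u ∉ terms a b c → v ∉ terms a b c → part u ≠ part v → (w s(u, v) : ℝ) = 0) :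
    (prodBernoulli w).real (badP a b c part) = 0 := by
  set P : Finset (Sym2 V) := ((Finset.univ ×ˢ Finset.univ).filter fun uv : V × V =>
      uv.1 ∉ terms a b c ∧ uv.2 ∉ terms a b c ∧ part uv.1 ≠ part uv.2).image fun uv => s(uv.1, uv.2) with hP
  have hsub : badP a b c part ⊆ {ω : BondConfig V | ∃ e ∈ P, e ∈ ω} := by
    rintro ω ⟨u, v, hu, hv, huv, he⟩
    refine ⟨s(u, v), ?_, he⟩
    rw [hP, Finset.mem_image]
    exact ⟨(u, v), Finset.mem_filter.2 ⟨Finset.mem_product.2 ⟨Finset.mem_univ _, Finset.mem_univ _⟩, hu, hv, huv⟩, rfl⟩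
  refine le_antisymm ?_ measureReal_nonneg
  refine (measureReal_mono hsub).trans ((prodBernoulli_real_exists_mem_le_sum w P).trans (le_of_eq (Finset.sum_eq_zero ?_)))
  intro e he
  rw [hP, Finset.mem_image] at he
  obtain ⟨⟨u, v⟩, huv, rfl⟩ := he
  rw [Finset.mem_filter] at huv
  exact hw u v huv.2.1 huv.2.2.1 huv.2.2.2

end prob

/-! ## Transfer to the connection events -/

section transfer
variable (w : Sym2 V → unitInterval) {a b c : V} (part : V → ι)

/-- `P(a isolated) = P(isoP a b c)`. [this work] -/
theorem real_isoPa (hab : a ≠ b) (hac : a ≠ c) (hN : (prodBernoulli w).real (badP a b c part) = 0) :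
    (prodBernoulli w).real ((openConn a b)ᶜ ∩ (openConn a c)ᶜ) = (prodBernoulli w).real (isoP a b c part a b c) := by
  have hT : ∀ v, v ∈ terms a b c → v = a ∨ v = b ∨ v = c := fun v hv => mem_terms.1 hv
  have e : ((openConn a b)ᶜ ∩ (openConn a c)ᶜ) ∩ (badP a b c part)ᶜ = isoP a b c part a b c ∩ (badP a b c part)ᶜ := by
    ext ω
    simp only [mem_inter_iff, mem_compl_iff]
    constructor
    · rintro ⟨⟨h1, h2⟩, hn⟩
      exact ⟨(isoP_iff hT (mem_terms.2 (Or.inl rfl)) (mem_terms.2 (Or.inr (Or.inl rfl))) (mem_terms.2 (Or.inr (Or.inr rfl))) hab hac hn).2 ⟨h1, h2⟩, hn⟩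
    · rintro ⟨h, hn⟩
      exact ⟨(isoP_iff hT (mem_terms.2 (Or.inl rfl)) (mem_terms.2 (Or.inr (Or.inl rfl))) (mem_terms.2 (Or.inr (Or.inr rfl))) hab hac hn).1 h, hn⟩
  rw [← ThreePointVarianceCutVertex.real_inter_compl_of_null w hN ((openConn a b)ᶜ ∩ (openConn a c)ᶜ), e,
    ThreePointVarianceCutVertex.real_inter_compl_of_null w hN]

/-- `P(b isolated) = P(isoP b a c)`. [this work] -/
theorem real_isoPb (hab : a ≠ b) (hbc : b ≠ c) (hN : (prodBernoulli w).real (badP a b c part) = 0) :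
    (prodBernoulli w).real ((openConn a b)ᶜ ∩ (openConn b c)ᶜ) = (prodBernoulli w).real (isoP a b c part b a c) := by
  have hT : ∀ v, v ∈ terms a b c → v = b ∨ v = a ∨ v = c := fun v hv => by rw [mem_terms] at hv; tauto
  have e : ((openConn a b)ᶜ ∩ (openConn b c)ᶜ) ∩ (badP a b c part)ᶜ = isoP a b c part b a c ∩ (badP a b c part)ᶜ := by
    ext ω
    simp only [mem_inter_iff, mem_compl_iff]
    constructor
    · rintro ⟨⟨h1, h2⟩, hn⟩
      refine ⟨(isoP_iff hT (mem_terms.2 (Or.inr (Or.inl rfl))) (mem_terms.2 (Or.inl rfl)) (mem_terms.2 (Or.inr (Or.inr rfl))) (Ne.symm hab) hbc hn).2 ⟨fun h => h1 ?_, h2⟩, hn⟩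
      exact SimpleGraph.Reachable.symm h
    · rintro ⟨h, hn⟩
      obtain ⟨h1, h2⟩ := (isoP_iff hT (mem_terms.2 (Or.inr (Or.inl rfl))) (mem_terms.2 (Or.inl rfl)) (mem_terms.2 (Or.inr (Or.inr rfl))) (Ne.symm hab) hbc hn).1 h
      exact ⟨⟨fun h => h1 (SimpleGraph.Reachable.symm h), h2⟩, hn⟩
  rw [← ThreePointVarianceCutVertex.real_inter_compl_of_null w hN ((openConn a b)ᶜ ∩ (openConn b c)ᶜ), e,
    ThreePointVarianceCutVertex.real_inter_compl_of_null w hN]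

/-- `P(c isolated) = P(isoP c a b)`. [this work] -/
theorem real_isoPc (hac : a ≠ c) (hbc : b ≠ c) (hN : (prodBernoulli w).real (badP a b c part) = 0) :
    (prodBernoulli w).real ((openConn a c)ᶜ ∩ (openConn b c)ᶜ) = (prodBernoulli w).real (isoP a b c part c a b) := by
  have hT : ∀ v, v ∈ terms a b c → v = c ∨ v = a ∨ v = b := fun v hv => by rw [mem_terms] at hv; tauto
  have e : ((openConn a c)ᶜ ∩ (openConn b c)ᶜ) ∩ (badP a b c part)ᶜ = isoP a b c part c a b ∩ (badP a b c part)ᶜ := by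
    ext ω
    simp only [mem_inter_iff, mem_compl_iff]
    constructor
    · rintro ⟨⟨h1, h2⟩, hn⟩
      refine ⟨(isoP_iff hT (mem_terms.2 (Or.inr (Or.inr rfl))) (mem_terms.2 (Or.inl rfl)) (mem_terms.2 (Or.inr (Or.inl rfl))) (Ne.symm hac) (Ne.symm hbc) hn).2
        ⟨fun h => h1 ?_, fun h => h2 ?_⟩, hn⟩
      · exact SimpleGraph.Reachable.symm h
      · exact SimpleGraph.Reachable.symm h
    · rintro ⟨h, hn⟩
      obtain ⟨h1, h2⟩ := (isoP_iff hT (mem_terms.2 (Or.inr (Or.inr rfl))) (mem_terms.2 (Or.inl rfl)) (mem_terms.2 (Or.inr (Or.inl rfl))) (Ne.symm hac) (Ne.symm hbc) hn).1 h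
      exact ⟨⟨fun h => h1 (SimpleGraph.Reachable.symm h), fun h => h2 (SimpleGraph.Reachable.symm h)⟩, hn⟩
  rw [← ThreePointVarianceCutVertex.real_inter_compl_of_null w hN ((openConn a c)ᶜ ∩ (openConn b c)ᶜ), e,
    ThreePointVarianceCutVertex.real_inter_compl_of_null w hN]

/-- `P(sep) = P(isoP a b c ∩ isoP b a c)`. [this work] -/
theorem real_sepP' (hab : a ≠ b) (hac : a ≠ c) (hbc : b ≠ c) (hN : (prodBernoulli w).real (badP a b c part) = 0) :
    (prodBernoulli w).real (((openConn a b)ᶜ ∩ (openConn a c)ᶜ) ∩ ((openConn a b)ᶜ ∩ (openConn b c)ᶜ)) =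
      (prodBernoulli w).real (isoP a b c part a b c ∩ isoP a b c part b a c) := by
  have hTa : ∀ v, v ∈ terms a b c → v = a ∨ v = b ∨ v = c := fun v hv => mem_terms.1 hv
  have hTb : ∀ v, v ∈ terms a b c → v = b ∨ v = a ∨ v = c := fun v hv => by rw [mem_terms] at hv; tauto
  have e : (((openConn a b)ᶜ ∩ (openConn a c)ᶜ) ∩ ((openConn a b)ᶜ ∩ (openConn b c)ᶜ)) ∩ (badP a b c part)ᶜ =
      (isoP a b c part a b c ∩ isoP a b c part b a c) ∩ (badP a b c part)ᶜ := by
    ext ω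
    simp only [mem_inter_iff, mem_compl_iff]
    constructor
    · rintro ⟨⟨⟨h1, h2⟩, -, h3⟩, hn⟩
      refine ⟨⟨(isoP_iff hTa (mem_terms.2 (Or.inl rfl)) (mem_terms.2 (Or.inr (Or.inl rfl))) (mem_terms.2 (Or.inr (Or.inr rfl))) hab hac hn).2 ⟨h1, h2⟩,
        (isoP_iff hTb (mem_terms.2 (Or.inr (Or.inl rfl))) (mem_terms.2 (Or.inl rfl)) (mem_terms.2 (Or.inr (Or.inr rfl))) (Ne.symm hab) hbc hn).2
          ⟨fun h => h1 (SimpleGraph.Reachable.symm h), h3⟩⟩, hn⟩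
    · rintro ⟨⟨hA, hB⟩, hn⟩
      obtain ⟨h1, h2⟩ := (isoP_iff hTa (mem_terms.2 (Or.inl rfl)) (mem_terms.2 (Or.inr (Or.inl rfl))) (mem_terms.2 (Or.inr (Or.inr rfl))) hab hac hn).1 hA
      obtain ⟨-, h3⟩ := (isoP_iff hTb (mem_terms.2 (Or.inr (Or.inl rfl))) (mem_terms.2 (Or.inl rfl)) (mem_terms.2 (Or.inr (Or.inr rfl))) (Ne.symm hab) hbc hn).1 hB
      exact ⟨⟨⟨h1, h2⟩, h1, h3⟩, hn⟩
  rw [← ThreePointVarianceCutVertex.real_inter_compl_of_null w hN (((openConn a b)ᶜ ∩ (openConn a c)ᶜ) ∩ _), e,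
    ThreePointVarianceCutVertex.real_inter_compl_of_null w hN]

end transfer

end Summit.CriticalPhenomena.PercolationContinuityZ3.Theorems.ThreePointPieces
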